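import Summits.BirchSwinnertonDyer.BirchSwinnertonDyer.Theorems.GenusKolyvaginAtTwoEquivariantChebotarevAtTwoFourStructure
import Literature.NumberTheory.EllipticCurves.TwoAdicImageSurjectivityModTwoProofs
import Literature.NumberTheory.QuadraticFields.ThreeTorsion

/-!
# Route `GenusKolyvaginAtTwo`, LINE 6, Q5 `EquivariantChebotarevAtTwo`: at `K = ℚ(√Δ_E)` NO element
# of `Γ_K` acts on `E[2]` as a transposition (`ρ̄_{E,2}(Γ_K) ⊆ A₃`) — the Galois hypothesis of the
# negative lemma `…FalseOfDiscFieldClassAtTwo` from the NEGATION of the parent's binder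
# (helper, PROVED; seat gk2-p2 g6; route-independent)

The refined negative booking of item stmt-BirchSwinnertonDyer-24881 (p608405,
`GenusExact.equivariantChebotarevAtTwo_false_of_DiscFieldClassAtTwo`) assumes a `(W, K, c)` in Q5's
range such that an element of `Γ_K` fixing one non-zero `2`-torsion point fixes them all
(`DiscFieldClassData.noTransposition`). This file derives that hypothesis from the arithmetic one
the parent crux 22137 EXCLUDES: `IsSquare ((d_K : ℚ) · Δ_W)` (on `Δ_W < 0` the negation of the
parent's `¬ IsSquare ((d_K : ℚ) · (−|Δ_W|))`), i.e. `K = ℚ(√Δ_W)`: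

* `isSquare_baseChange_Δ_of_isSquare_discr_mul` — `d_K · Δ ∈ ℚ^{×2}` and `[K:ℚ] = 2` give
  `Δ ∈ K^{×2}` (`√d_K ∈ K`, Marcus Ch. 2 Thm. 1 via `Quadratic.exists_not_mem_range_sq_eq_discr`);
* `smul_eq_of_isSquare_Δ` — over any perfect field of characteristic `≠ 2`: if `Δ ∈ K^{×2}` then
  every `σ ∈ Γ_K` fixes `δ = ∏(xᵢ − xⱼ)` (tree `DokchitserDokchitser2012.isSquare_Δ_iff_forall_smul_delta`),
  so `sign (permGal σ) = 1` (`smul_delta`: `σδ = sign(σ)δ`, `δ ≠ 0`, `2 ≠ 0`), and an EVEN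
  permutation of the three non-zero `2`-torsion points fixing one of them is the identity;
* `noTransposition_of_isSquare_discr_mul` — the field `noTransposition` of `DiscFieldClassData`
  for `W/ℚ`, `K` quadratic with `IsSquare ((d_K : ℚ) · Δ_W)`, at the level `2 = 2^1` of Q5 (`M = 1`).

Consequently `DiscFieldClassAtTwo` (hence `¬ EquivariantChebotarevAtTwo`) follows from: a non-CM,
globally minimal `W/ℚ` with `Δ < 0` and `ρ_{W,2^n}` onto for all `n`, an imaginary quadratic `K`
with `d_K · Δ_W ∈ ℚ^{×2}` and `c ≠ 1`, and ONE class `x ∈ H¹(K, E[2])` generic with respect to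
`x^c` — exactly the range the parent's binder removes. HONEST FRAMING: helper theorems
(`--supports 24881`); nothing closed; BSD is not proved by any of this.

References: [DokchitserDokchitserMathZ2012] Thm. (1) and its proof (`ℚ(E[2]) ⊇ ℚ(√Δ)`);
[GrossLMS1991] §9 (standing hypothesis `K ⊄ ℚ(E_p)`); [Kolyvagin1989] Thm. B;
[MarcusNumberFields1977] Ch. 2 Thm. 1.
-/

set_option autoImplicit false
set_option linter.dupNamespace false

noncomputable section

open scoped Classical

namespace Summit.BirchSwinnertonDyer.BirchSwinnertonDyer.Theorems.GenusExact

open WeierstrassCurve NumberField IsDedekindDomain Field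
open Literature.NumberTheory.GaloisRepresentations Literature.NumberTheory.EllipticCurves
open Literature.NumberTheory
open Literature.NumberTheory.EllipticCurves.DokchitserDokchitser2012
open Literature.NumberTheory.QuadraticFields

universe u

/-! ### §1 `Δ ∈ K^{×2}` from `d_K · Δ ∈ ℚ^{×2}` -/

/-- **`d_K · Δ ∈ ℚ^{×2}` makes `Δ` a square in the quadratic field `K`** (`√d_K ∈ K`:
`Δ = q²/d_K = (q·√d_K/d_K)²`). [folklore] -/
theorem isSquare_baseChange_Δ_of_isSquare_discr_mul (W : WeierstrassCurve ℚ)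
    (K : Type) [Field K] [NumberField K] (hK2 : Module.finrank ℚ K = 2)
    (hsq : IsSquare ((NumberField.discr K : ℚ) * W.Δ)) : IsSquare (W.baseChange K).Δ := by
  have hΔ : (W.baseChange K).Δ = algebraMap ℚ K W.Δ := by rw [baseChange, map_Δ]
  obtain ⟨γ, -, hγ⟩ := Quadratic.exists_not_mem_range_sq_eq_discr (K := K) hK2
  obtain ⟨q, hq⟩ := hsq
  have hd : (NumberField.discr K : ℚ) ≠ 0 := by exact_mod_cast NumberField.discr_ne_zero K
  refine ⟨algebraMap ℚ K (q / NumberField.discr K) * γ, ?_⟩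
  rw [hΔ, show W.Δ = q * q / NumberField.discr K by rw [← hq]; field_simp]
  have : algebraMap ℚ K (q * q / NumberField.discr K) =
      algebraMap ℚ K (q / NumberField.discr K) * algebraMap ℚ K (q / NumberField.discr K) *
        algebraMap ℚ K (NumberField.discr K : ℚ) := by
    rw [← map_mul, ← map_mul]; congr 1; field_simp
  rw [this, ← hγ]; ring

/-! ### §2 `Δ ∈ K^{×2}` ⟹ `ρ̄_{E,2}(Γ_K) ⊆ A₃`: no element acts as a transposition -/

section Perfect

variable {K : Type u} [Field K] [PerfectField K] (X : WeierstrassCurve K) [X.IsElliptic]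
  (h2 : (2 : K) ≠ 0)

/-- An even permutation of three letters with a fixed point is the identity. [folklore] -/
private theorem perm_three_eq_one_of_sign_of_fixed :
    ∀ p : Equiv.Perm (Fin 3), Equiv.Perm.sign p = 1 → ∀ i : Fin 3, p i = i → p = 1 := by
  decide

include h2 in
/-- **`Δ ∈ K^{×2}` ⟹ every `σ ∈ Γ_K` permutes the non-zero `2`-torsion points EVENLY**
(`σδ = sign(σ)δ` with `δ ≠ 0`, `char K ≠ 2`, and `δ ∈ K` iff `Δ = 16δ² ∈ K^{×2}`).
[cite: DokchitserDokchitserMathZ2012, Theorem (1), proof (ℚ(E[2]) ⊃ ℚ(√Δ))] -/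
theorem sign_permGal_eq_one_of_isSquare_Δ (hsq : IsSquare X.Δ) (σ : absoluteGaloisGroup K) :
    Equiv.Perm.sign (permGal X h2 σ) = 1 := by
  have hδ : σ • delta X h2 = delta X h2 := (isSquare_Δ_iff_forall_smul_delta X h2).mp hsq σ
  rcases Int.units_eq_one_or (Equiv.Perm.sign (permGal X h2 σ)) with h | h
  · exact h
  · exfalso
    have hs := smul_delta X h2 σ
    rw [hδ, h] at hs
    -- `δ = -δ` with `δ ≠ 0` and `2 ≠ 0`
    have h2' : (2 : AlgebraicClosure K) ≠ 0 := fun h0 ↦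
      h2 ((algebraMap K (AlgebraicClosure K)).injective (by rw [map_ofNat, h0, map_zero]))
    apply delta_ne_zero X h2
    have : (2 : AlgebraicClosure K) * delta X h2 = 0 := by
      rw [two_mul]
      nth_rewrite 2 [hs]
      push_cast
      ring
    exact (mul_eq_zero.mp this).resolve_left h2'

include h2 in
/-- **`Δ ∈ K^{×2}` ⟹ no element of `Γ_K` acts on `E(K̄)[2]` as a transposition**: an element
fixing one non-zero `2`-torsion point fixes all of them (its permutation of `{T₀, T₁, T₂}` is even
with a fixed letter, hence trivial). [cite: DokchitserDokchitserMathZ2012, Theorem (1), proof] -/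
theorem smul_eq_of_isSquare_Δ (hsq : IsSquare X.Δ) (σ : absoluteGaloisGroup K)
    (u : geomTorsion X 2) (hu0 : u ≠ 0) (hu : σ • u = u) (w : geomTorsion X 2) : σ • w = w := by
  obtain ⟨i, rfl⟩ : ∃ i, u = T X h2 i := (eq_zero_or_eq_T X h2 u).resolve_left hu0
  have hi : permGal X h2 σ i = i := T_injective X h2 (by rw [T_permGal, hu])
  have h1 : permGal X h2 σ = 1 :=
    perm_three_eq_one_of_sign_of_fixed _ (sign_permGal_eq_one_of_isSquare_Δ X h2 hsq σ) i hi
  rcases eq_zero_or_eq_T X h2 w with rfl | ⟨j, rfl⟩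
  · exact smul_zero σ
  · rw [← T_permGal, h1, Equiv.Perm.one_apply]

end Perfect

/-! ### §3 The Galois hypothesis of `DiscFieldClassData` from `d_K · Δ ∈ ℚ^{×2}` -/

/-- **At the discriminant field no element of `Γ_K` acts on `E[2]` as a transposition**: for `W/ℚ`
elliptic and a quadratic `K` with `d_K · Δ_W ∈ ℚ^{×2}` (i.e. `K = ℚ(√Δ_W)`), an element of `Γ_K`
fixing one non-zero point of `E(K̄)[2]` fixes all of them — the field `noTransposition` of
`DiscFieldClassData`, at the level `2 = 2^1` of Q5 (`M = 1`). Together with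
`equivariantChebotarevAtTwo_false_of_DiscFieldClassAtTwo` (p608405): Q5 as typed fails at every
`(W, K)` of its range with `d_K · Δ_W ∈ ℚ^{×2}` carrying one generic class.
[cite: DokchitserDokchitserMathZ2012, Theorem (1), proof (ℚ(E[2]) ⊃ ℚ(√Δ))]
[cite: GrossLMS1991, §9 (standing hypothesis K ⊄ ℚ(E_p))] -/
theorem noTransposition_of_isSquare_discr_mul (W : WeierstrassCurve ℚ) [W.IsElliptic]
    (K : Type) [Field K] [NumberField K] (hK2 : Module.finrank ℚ K = 2)
    (hsq : IsSquare ((NumberField.discr K : ℚ) * W.Δ))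
    (g : absoluteGaloisGroup K) (u : geomTorsion (W.baseChange K) ((2 ^ 1 : ℕ) : ℤ))
    (hu0 : u ≠ 0) (hu : g • u = u) (w : geomTorsion (W.baseChange K) ((2 ^ 1 : ℕ) : ℤ)) :
    g • w = w := by
  haveI : (W.baseChange K).IsElliptic := by rw [baseChange]; infer_instance
  have h2 : (2 : K) ≠ 0 := two_ne_zero
  have hsqK := isSquare_baseChange_Δ_of_isSquare_discr_mul W K hK2 hsq
  exact smul_eq_of_isSquare_Δ (W.baseChange K) h2 hsqK g u hu0 hu w

/-- **The negation of the parent's binder on `Δ < 0`**: `IsSquare (d_K · (−|Δ|))` is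
`IsSquare (d_K · Δ)`. [folklore] -/
theorem isSquare_discr_mul_iff_of_Δ_neg (W : WeierstrassCurve ℚ) (hΔ : W.Δ < 0)
    (K : Type) [Field K] [NumberField K] :
    IsSquare ((NumberField.discr K : ℚ) * -|W.Δ|) ↔ IsSquare ((NumberField.discr K : ℚ) * W.Δ) := by
  rw [abs_of_neg hΔ, neg_neg]

end Summit.BirchSwinnertonDyer.BirchSwinnertonDyer.Theorems.GenusExact

end
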